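import Literature.Topology.FourManifolds.DehnNielsenBaerTorus
import Mathlib.Analysis.Convex.Contractible
import Mathlib.Analysis.SpecialFunctions.Complex.Circle
import HarnessLib

/-!
# The meridian kernel of the round solid torus: `ker (π₁ ∂V → π₁ V) = ⟨g₂⟩`

Topic `Literature/Topology/FourManifolds`; written for the fact debt
`Literature.Topology.FourManifolds.GriffithsExtension` (`HandlebodyKernelExtension.lean`;
H. B. Griffiths, *Automorphisms of a 3-dimensional handlebody*, Abh. Math. Sem. Univ. Hamburg 26
(1964), main theorem: a self-diffeomorphism of the boundary of a genus-`g` handlebody preserving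
`ker (π₁ ∂H → π₁ H)` extends), whose genus-`1` model is the round solid torus
`V = RoundSolidTorus = {(x² + y² − 4)² + 16 z² ≤ 1} ⊂ ℝ³` (`RoundSolidTorus.lean`,
`HandlebodyKernelExtensionModel.lean`, `griffithsExtension_of_roundSolidTorus_of_flower`).  Every
use of Griffiths' kernel condition on the model starts from the identification of the kernel
proved here.  Everything is **proved**; the new definitions are concrete maps and loop classes
with bodies; no named fact is introduced.

* §1 `RoundSolidTorusModel.longitude : V → ℝ/2πℤ`, the longitude angle `arg (x + iy)` of a point
  of `V` (all of `V` lies off the `z`-axis, `x² + y² ≥ 3`), continuous, and equal to the first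
  angle coordinate on `∂V` (`longitude_boundaryHomeomorphAngle_symm`).
* §2 `RoundSolidTorusModel.discMap : D² → V`, the meridian disc `{y = 0, x > 0} ∩ V`
  parametrised by the closed unit disc of `ℂ`, `w ↦ (√(4 + Re w), 0, Im w / 4)`; its boundary
  circle is the meridian of `∂V` through the base point.
* §3 `RoundSolidTorusModel.meridianClass`, `longitudeClass` — the standard generators
  `g₂ = (0, ω)`, `g₁ = (ω, 0)` of `π₁(∂V, z₀) ≅ π₁(ℝ/2πℤ × ℝ/2πℤ, 0) ≅ ℤ²` pulled back along the
  angle homeomorphism (`boundaryHomeomorphAddCircle`, Hatcher Example 1.13); **the meridian dies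
  in `V`** (`map_incl_meridianClass`: it bounds the meridian disc, which is simply connected),
  **the longitude survives** (`fst_eq_zero_of_map_incl_eq_one`: the longitude angle `V → S¹`
  sends `g₁` to the generator of `π₁(S¹) ≅ ℤ`, of infinite order, Hatcher Thm. 1.7), and
  **`ker (π₁(∂V, z₀) → π₁(V, z₀)) = ⟨g₂⟩`** (`ker_map_incl_eq_zpowers_meridianClass`), the
  genus-`1` case of "the kernel of `π₁ ∂H → π₁ H` is normally generated by the meridians"
  (Hempel, *3-Manifolds* (1976), Ch. 14, p. 158; Rolfsen, *Knots and Links* (1976), §2.E: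
  `π₁` of the solid torus is `ℤ` generated by the longitude, the meridian bounds a disc).

## References

* A. Hatcher, *Algebraic Topology* (2002), Thm. 1.7, Prop. 1.12, Example 1.13, Prop. 1.18.
  [HatcherAT2002]
* J. Hempel, *3-Manifolds*, Ann. of Math. Studies 86 (1976), Ch. 14, p. 158. [Hempel1976]
* H. B. Griffiths, *Automorphisms of a 3-dimensional handlebody*, Abh. Math. Sem. Univ. Hamburg
  26 (1964) 191–210. [GriffithsHB1964Handlebody]
-/

open scoped Manifold ContDiff Topology Real
open Set Function

noncomputable section

namespace Literature.Topology.FourManifolds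

open Literature.AlgebraicTopology.FundamentalGroup Literature.Topology.Euclidean

namespace RoundSolidTorusModel

/-! ### §1 The longitude angle of a point of `V` -/

/-- Points of `{G ≤ 0}` satisfy `3 ≤ x² + y²` (from `(x² + y² − 4)² ≤ 1`). [folklore] -/
theorem three_le_sq_add_sq_of_G_nonpos {q : EuclideanSpace ℝ (Fin 3)} (h : G q ≤ 0) :
    3 ≤ q 0 ^ 2 + q 1 ^ 2 := by
  simp only [G] at h
  set s := q 0 ^ 2 + q 1 ^ 2 with hs
  have h1 : (s - 4) ^ 2 ≤ 1 := by nlinarith [sq_nonneg (q 2)]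
  nlinarith [h1]

/-- Points of `{G ≤ 0}` satisfy `normSq ((x² + y² − 4) + 4iz) ≤ 1`, i.e. `G = |merC|² − 1`. [folklore] -/
theorem G_eq_normSq_merC (q : EuclideanSpace ℝ (Fin 3)) : G q = Complex.normSq (merC q) - 1 := by
  simp only [G, merC, Complex.normSq_apply, Complex.add_re, Complex.ofReal_re, Complex.mul_re,
    Complex.I_re, Complex.ofReal_im, Complex.I_im, Complex.add_im, Complex.mul_im]
  ring

/-- Points of `V` satisfy `3 ≤ x² + y²`. [folklore] -/
theorem three_le_sq_add_sq (p : RoundSolidTorus) :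
    3 ≤ (RegularSublevel.incl isRegularLevel_fn p) 0 ^ 2 + (RegularSublevel.incl isRegularLevel_fn p) 1 ^ 2 :=
  three_le_sq_add_sq_of_G_nonpos ((fn_nonpos_iff _).1 (RegularSublevel.apply_incl_le isRegularLevel_fn p))

/-- Points of `V` lie off the `z`-axis: `0 < x² + y²`. [folklore] -/
theorem sq_add_sq_pos (p : RoundSolidTorus) :
    0 < (RegularSublevel.incl isRegularLevel_fn p) 0 ^ 2 + (RegularSublevel.incl isRegularLevel_fn p) 1 ^ 2 :=
  lt_of_lt_of_le (by norm_num) (three_le_sq_add_sq p)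

/-- The complex number `x + iy` of a point of `ℝ³`. [folklore] -/
def xyC (q : EuclideanSpace ℝ (Fin 3)) : ℂ := (q 0 : ℂ) + (q 1 : ℂ) * Complex.I

/-- `xyC` is continuous. [folklore] -/
theorem continuous_xyC : Continuous xyC := by
  unfold xyC; fun_prop

/-- `normSq (x + iy) = x² + y²`. [folklore] -/
theorem normSq_xyC (q : EuclideanSpace ℝ (Fin 3)) : Complex.normSq (xyC q) = q 0 ^ 2 + q 1 ^ 2 := by
  simp only [xyC, Complex.normSq_apply, Complex.add_re, Complex.ofReal_re, Complex.mul_re,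
    Complex.I_re, Complex.ofReal_im, Complex.I_im, Complex.add_im, Complex.mul_im]
  ring

/-- `x + iy ≠ 0` at the points of `V`. [folklore] -/
theorem xyC_incl_ne_zero (p : RoundSolidTorus) : xyC (RegularSublevel.incl isRegularLevel_fn p) ≠ 0 := by
  intro h
  have h2 := normSq_xyC (RegularSublevel.incl isRegularLevel_fn p)
  rw [h, map_zero] at h2
  linarith [sq_add_sq_pos p]

/-- **The longitude angle of a point of the round solid torus**: `arg (x + iy) ∈ ℝ/2πℤ` (the
solid torus `V` winds around the `z`-axis, which it avoids). [folklore] -/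
def longitude (p : RoundSolidTorus) : Real.Angle :=
  (Complex.arg (xyC (RegularSublevel.incl isRegularLevel_fn p)) : Real.Angle)

/-- The longitude angle is continuous on `V` (the argument is continuous into `ℝ/2πℤ` off the
origin). [folklore] -/
theorem continuous_longitude : Continuous longitude := by
  rw [continuous_iff_continuousAt]
  intro p
  have h := Complex.continuousAt_arg_coe_angle (xyC_incl_ne_zero p)
  have h2 : ContinuousAt (fun p : RoundSolidTorus => xyC (RegularSublevel.incl isRegularLevel_fn p)) p :=
    (continuous_xyC.comp (RegularSublevel.continuous_incl isRegularLevel_fn)).continuousAt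
  exact ContinuousAt.comp (f := fun p : RoundSolidTorus => xyC (RegularSublevel.incl isRegularLevel_fn p)) h h2

/-- The longitude angle as a continuous map `V → ℝ/2πℤ` (target written as `AddCircle (2π)`, the
type of the angle coordinates of `boundaryHomeomorphAddCircle`; `Real.Angle` is this type). [folklore] -/
def longitudeMap : C(RoundSolidTorus, AddCircle (2 * Real.pi)) :=
  ⟨fun p => show AddCircle (2 * Real.pi) from longitude p, by exact continuous_longitude⟩

/-- `longitudeMap` as a function. [folklore] -/
theorem longitudeMap_apply (p : RoundSolidTorus) :
    longitudeMap p = (show AddCircle (2 * Real.pi) from longitude p) := rfl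

/-- `x + iy` on the parametrised torus is `ρ(φ) e^{iθ}`. [folklore] -/
theorem xyC_torusParam (θφ : Real.Angle × Real.Angle) :
    xyC (torusParam 4 1 (1 / 4) θφ) =
      (torusRadius 4 1 θφ.2 : ℂ) * (Complex.cos (θφ.1.toReal : ℂ) + Complex.sin (θφ.1.toReal : ℂ) * Complex.I) := by
  rw [xyC, torusParam_apply_zero, torusParam_apply_one, ← Real.Angle.cos_toReal, ← Real.Angle.sin_toReal]
  push_cast
  ring

/-- **On the boundary torus the longitude angle is the first angle coordinate.** [folklore] -/
theorem longitude_boundaryHomeomorphAngle_symm (θφ : Real.Angle × Real.Angle) :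
    longitude (boundaryHomeomorphAngle.symm θφ).1 = θφ.1 := by
  rw [longitude, incl_boundaryHomeomorphAngle_symm, xyC_torusParam,
    Complex.arg_mul_cos_add_sin_mul_I (torusRadius_pos one_lt_four' zero_le_one θφ.2)
      (Real.Angle.toReal_mem_Ioc θφ.1), Real.Angle.coe_toReal]

/-- On `∂V`, `longitude = pr₁ ∘ angles`. [folklore] -/
theorem longitude_boundary (z : (𝓡∂ 3).boundary RoundSolidTorus) :
    longitude z.1 = (boundaryHomeomorphAngle z).1 := by
  conv_lhs => rw [← boundaryHomeomorphAngle.symm_apply_apply z]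
  rw [longitude_boundaryHomeomorphAngle_symm]

/-! ### §2 The meridian disc -/

/-- The point `(√(4 + Re w), 0, Im w / 4)` of the meridian half-plane `{y = 0, x > 0}` with
meridian coordinate `w` (so that `(x² − 4) + 4iz = w`). [folklore] -/
def discPt (w : ℂ) : EuclideanSpace ℝ (Fin 3) := !₂[√(4 + w.re), 0, w.im / 4]

/-- First coordinate of `discPt`. [folklore] -/
@[simp] theorem discPt_apply_zero (w : ℂ) : discPt w 0 = √(4 + w.re) := by simp [discPt]

/-- Second coordinate of `discPt`. [folklore] -/
@[simp] theorem discPt_apply_one (w : ℂ) : discPt w 1 = 0 := by simp [discPt]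

/-- Third coordinate of `discPt`. [folklore] -/
@[simp] theorem discPt_apply_two (w : ℂ) : discPt w 2 = w.im / 4 := by simp [discPt]

/-- `discPt` is continuous. [folklore] -/
theorem continuous_discPt : Continuous discPt := by
  unfold discPt
  fun_prop

/-- On the closed unit disc, `G (discPt w) = |w|² − 1`. [folklore] -/
theorem G_discPt {w : ℂ} (hw : -4 ≤ w.re) : G (discPt w) = Complex.normSq w - 1 := by
  have hs : √(4 + w.re) ^ 2 = 4 + w.re := Real.sq_sqrt (by linarith)
  simp only [G, discPt_apply_zero, discPt_apply_one, discPt_apply_two, Complex.normSq_apply, hs]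
  ring

/-- The meridian disc lies in `V`: `f (discPt w) ≤ 0` for `|w| ≤ 1`. [folklore] -/
theorem fn_discPt_nonpos {w : ℂ} (hw : ‖w‖ ≤ 1) : fn (discPt w) ≤ 0 := by
  have hre : -4 ≤ w.re := by
    have := (abs_le.1 ((Complex.abs_re_le_norm w).trans hw)).1; linarith
  rw [fn_nonpos_iff, G_discPt hre, sub_nonpos, Complex.normSq_eq_norm_sq]
  nlinarith [norm_nonneg w]

/-- **The meridian disc of `V` through the base point**, parametrised by the closed unit disc of
`ℂ`: `w ↦ (√(4 + Re w), 0, Im w / 4)`. [folklore] -/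
def discMap (w : Metric.closedBall (0 : ℂ) 1) : RoundSolidTorus :=
  RegularSublevel.mk isRegularLevel_fn (discPt w) (fn_discPt_nonpos (mem_closedBall_zero_iff.1 w.2))

/-- `discMap` in `ℝ³`. [folklore] -/
@[simp] theorem incl_discMap (w : Metric.closedBall (0 : ℂ) 1) :
    RegularSublevel.incl isRegularLevel_fn (discMap w) = discPt w := rfl

/-- `discMap` is continuous. [folklore] -/
theorem continuous_discMap : Continuous discMap :=
  (RegularSublevel.isEmbedding_incl isRegularLevel_fn).continuous_iff.2
    (continuous_discPt.comp continuous_subtype_val)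

/-- The unit complex number `cos φ + i sin φ` of an angle. [folklore] -/
def discBdryC (φ : Real.Angle) : ℂ := (φ.cos : ℂ) + (φ.sin : ℂ) * Complex.I

/-- Real part of `discBdryC`. [folklore] -/
@[simp] theorem discBdryC_re (φ : Real.Angle) : (discBdryC φ).re = φ.cos := by
  simp [discBdryC]

/-- Imaginary part of `discBdryC`. [folklore] -/
@[simp] theorem discBdryC_im (φ : Real.Angle) : (discBdryC φ).im = φ.sin := by
  simp [discBdryC]

/-- `discBdryC` is continuous. [folklore] -/
theorem continuous_discBdryC : Continuous discBdryC := by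
  unfold discBdryC
  exact (Complex.continuous_ofReal.comp Real.Angle.continuous_cos).add
    ((Complex.continuous_ofReal.comp Real.Angle.continuous_sin).mul continuous_const)

/-- `discBdryC φ` lies on the unit circle, in particular in the closed unit disc. [folklore] -/
theorem norm_discBdryC_le (φ : Real.Angle) : ‖discBdryC φ‖ ≤ 1 := by
  have h : Complex.normSq (discBdryC φ) = 1 := by
    rw [Complex.normSq_apply, discBdryC_re, discBdryC_im]
    nlinarith [Real.Angle.cos_sq_add_sin_sq φ]
  rw [Complex.normSq_eq_norm_sq] at h
  nlinarith [norm_nonneg (discBdryC φ)]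

/-- The point `cos φ + i sin φ` of the closed unit disc. [folklore] -/
def discBdryPt (φ : Real.Angle) : Metric.closedBall (0 : ℂ) 1 :=
  ⟨discBdryC φ, mem_closedBall_zero_iff.2 (norm_discBdryC_le φ)⟩

/-- `discBdryPt` is continuous. [folklore] -/
theorem continuous_discBdryPt : Continuous discBdryPt :=
  Continuous.subtype_mk continuous_discBdryC _

/-- **The meridian of `∂V` with longitude `0` bounds the meridian disc**: the boundary point with
angles `(0, φ)` is `discMap (cos φ + i sin φ)`. [folklore] -/
theorem boundaryHomeomorphAngle_symm_zero_eq_discMap (φ : Real.Angle) :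
    (boundaryHomeomorphAngle.symm (0, φ)).1 = discMap (discBdryPt φ) := by
  apply RegularSublevel.injective_incl isRegularLevel_fn
  rw [incl_boundaryHomeomorphAngle_symm, incl_discMap]
  ext i
  fin_cases i
  · show torusParam 4 1 (1 / 4) (0, φ) 0 = discPt (discBdryC φ) 0
    rw [torusParam_apply_zero, discPt_apply_zero, discBdryC_re, torusRadius]
    simp [Real.Angle.cos_zero]
  · show torusParam 4 1 (1 / 4) (0, φ) 1 = discPt (discBdryC φ) 1
    rw [torusParam_apply_one, discPt_apply_one]
    simp [Real.Angle.sin_zero]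
  · show torusParam 4 1 (1 / 4) (0, φ) 2 = discPt (discBdryC φ) 2
    rw [torusParam_apply_two, discPt_apply_two, discBdryC_im]
    ring

/-- The closed unit disc of `ℂ` is simply connected (convex). [folklore] -/
instance simplyConnectedSpace_closedBall : SimplyConnectedSpace (Metric.closedBall (0 : ℂ) 1) := by
  haveI : ContractibleSpace (Metric.closedBall (0 : ℂ) 1) :=
    (convex_closedBall (0 : ℂ) 1).contractibleSpace ⟨0, Metric.mem_closedBall_self zero_le_one⟩
  infer_instance

/-! ### §3 The meridian and longitude classes; the kernel -/

/-- `π₁(∂V, z₀) ≅ π₁(ℝ/2πℤ × ℝ/2πℤ, 0)` along the angle homeomorphism. [cite: HatcherAT2002, Prop. 1.18] -/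
abbrev congrTorus :
    FundamentalGroup ((𝓡∂ 3).boundary RoundSolidTorus) basePt ≃*
      FundamentalGroup (AddCircle (2 * Real.pi) × AddCircle (2 * Real.pi)) (0, 0) :=
  Homeomorph.fundamentalGroupCongr boundaryHomeomorphAddCircle boundaryHomeomorphAddCircle_basePt

/-- **The meridian class** `g₂ ∈ π₁(∂V, z₀)`: the loop `φ ↦ (angles)⁻¹ (0, φ)` (the second
standard generator of `π₁(T²) ≅ ℤ²`, Hatcher Example 1.13, pulled back to `∂V`).
[cite: HatcherAT2002, Example 1.13 (p. 34)] -/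
def meridianClass : FundamentalGroup ((𝓡∂ 3).boundary RoundSolidTorus) basePt :=
  congrTorus.symm (torusLoop₂ (2 * Real.pi))

/-- **The longitude class** `g₁ ∈ π₁(∂V, z₀)`: the loop `θ ↦ (angles)⁻¹ (θ, 0)`.
[cite: HatcherAT2002, Example 1.13 (p. 34)] -/
def longitudeClass : FundamentalGroup ((𝓡∂ 3).boundary RoundSolidTorus) basePt :=
  congrTorus.symm (torusLoop₁ (2 * Real.pi))

/-- `congrTorus g₂ = (0, ω)`. [folklore] -/
@[simp] theorem congrTorus_meridianClass : congrTorus meridianClass = torusLoop₂ (2 * Real.pi) :=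
  MulEquiv.apply_symm_apply _ _

/-- `congrTorus g₁ = (ω, 0)`. [folklore] -/
@[simp] theorem congrTorus_longitudeClass : congrTorus longitudeClass = torusLoop₁ (2 * Real.pi) :=
  MulEquiv.apply_symm_apply _ _

/-- **Every element of `π₁(∂V, z₀)` is `g₁^m g₂^n`.** [cite: HatcherAT2002, Example 1.13 (p. 34)] -/
theorem eq_longitudeClass_zpow_mul_meridianClass_zpow
    (γ : FundamentalGroup ((𝓡∂ 3).boundary RoundSolidTorus) basePt) :
    γ = longitudeClass ^ ((fundamentalGroupTorusEquiv Real.two_pi_pos.ne' Real.two_pi_pos.ne' 0 0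
          (congrTorus γ)).toAdd).1 *
      meridianClass ^ ((fundamentalGroupTorusEquiv Real.two_pi_pos.ne' Real.two_pi_pos.ne' 0 0
          (congrTorus γ)).toAdd).2 := by
  apply congrTorus.injective
  rw [map_mul, map_zpow, map_zpow, congrTorus_longitudeClass, congrTorus_meridianClass]
  exact eq_torusLoop₁_zpow_mul_torusLoop₂_zpow _ _

/-- The inclusion `∂V → V` as a continuous map (the `incl` of the boundary datum
`BoundaryManifold.boundaryData 2 V`). [folklore] -/
abbrev bdryIncl : C((𝓡∂ 3).boundary RoundSolidTorus, RoundSolidTorus) :=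
  ⟨(BoundaryManifold.boundaryData 2 RoundSolidTorus).incl,
    (BoundaryManifold.boundaryData 2 RoundSolidTorus).continuous_incl⟩

/-- `bdryIncl` is `Subtype.val`. [folklore] -/
@[simp] theorem bdryIncl_apply (z : (𝓡∂ 3).boundary RoundSolidTorus) : bdryIncl z = z.1 := rfl

/-- The meridian loop of `∂V` at the base point, `t ↦ (angles)⁻¹ (0, 2πt)`. [folklore] -/
def meridianPath : Path basePt basePt :=
  ((Path.refl (0 : AddCircle (2 * Real.pi))).prod (addCircleLoop (2 * Real.pi) 0)).map
    boundaryHomeomorphAddCircle.symm.continuous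

/-- `g₂ = [meridianPath]`. [folklore] -/
theorem meridianClass_eq_fromPath :
    meridianClass = FundamentalGroup.fromPath (Path.Homotopic.Quotient.mk meridianPath) := by
  rw [meridianClass, Homeomorph.fundamentalGroupCongr_symm_apply, FundamentalGroup.mapOfEq_apply]
  change FundamentalGroup.fromPath (((Path.Homotopic.Quotient.mk
    ((Path.refl (0 : AddCircle (2 * Real.pi))).prod (addCircleLoop (2 * Real.pi) 0))).map
      (boundaryHomeomorphAddCircle.symm :
        C(AddCircle (2 * Real.pi) × AddCircle (2 * Real.pi), ↥((𝓡∂ 3).boundary RoundSolidTorus)))).cast _ _) = _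
  rw [← Path.Homotopic.Quotient.mk_map, ← Path.Homotopic.Quotient.mk_cast]
  rfl

/-- The boundary circle of the meridian disc, `t ↦ e^{2πit}`, as a loop in the closed unit disc. [folklore] -/
def discLoop : Path (discBdryPt 0) (discBdryPt 0) where
  toFun t := discBdryPt (((t : ℝ) * (2 * Real.pi) : ℝ) : Real.Angle)
  continuous_toFun := continuous_discBdryPt.comp (by fun_prop)
  source' := congrArg discBdryPt (by rw [Set.Icc.coe_zero, zero_mul, Real.Angle.coe_zero])
  target' := congrArg discBdryPt (by rw [Set.Icc.coe_one, one_mul, Real.Angle.coe_two_pi])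

/-- The meridian loop, pushed into `V`, is the boundary of the meridian disc (pointwise). [folklore] -/
theorem meridianPath_map_val_apply (t : unitInterval) :
    (meridianPath.map continuous_subtype_val) t = discMap (discLoop t) := by
  change (boundaryHomeomorphAddCircle.symm ((0 : AddCircle (2 * Real.pi)),
    (0 : AddCircle (2 * Real.pi)) + ((((t : ℝ) * (2 * Real.pi) : ℝ) : AddCircle (2 * Real.pi))))).1 = _
  rw [zero_add]
  exact boundaryHomeomorphAngle_symm_zero_eq_discMap _

/-- A loop in `V` which factors through the meridian disc is null-homotopic (the disc is simply
connected). [folklore] -/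
theorem fromPath_eq_one_of_eq_discMap {x : RoundSolidTorus} (L : Path x x)
    {w : Metric.closedBall (0 : ℂ) 1} (δ : Path w w) (hx : x = discMap w)
    (h : ∀ t, L t = discMap (δ t)) :
    FundamentalGroup.fromPath (Path.Homotopic.Quotient.mk L) = 1 := by
  subst hx
  have hL : L = δ.map continuous_discMap := Path.ext (funext h)
  rw [hL, FundamentalGroup.one_def]
  have hδ : δ.Homotopic (Path.refl w) := SimplyConnectedSpace.paths_homotopic δ (Path.refl w)
  have hmap : (δ.map continuous_discMap).Homotopic ((Path.refl w).map continuous_discMap) :=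
    hδ.map ⟨discMap, continuous_discMap⟩
  have hrefl : (Path.refl w).map continuous_discMap = Path.refl (discMap w) := rfl
  rw [hrefl] at hmap
  rw [← Path.Homotopic.Quotient.mk_refl]
  exact Path.Homotopic.Quotient.eq.2 hmap

/-- **The meridian dies in `V`**: `incl_* g₂ = 1` in `π₁(V, z₀)` — the meridian bounds the
meridian disc (Rolfsen, *Knots and Links*, §2.E; Hempel (1976), p. 158).
[cite: Hempel1976, Ch. 14 p. 158] -/
theorem map_incl_meridianClass : FundamentalGroup.map bdryIncl basePt meridianClass = 1 := by
  rw [meridianClass_eq_fromPath]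
  change FundamentalGroup.fromPath (Path.Homotopic.Quotient.mk (meridianPath.map continuous_subtype_val)) = 1
  refine fromPath_eq_one_of_eq_discMap _ discLoop ?_ meridianPath_map_val_apply
  -- the base point is the point `discMap 1` of the disc
  have h := boundaryHomeomorphAngle_symm_zero_eq_discMap 0
  exact h

/-- `pr₁ ∘ angles = longitude ∘ incl` on `∂V`, as continuous maps into `ℝ/2πℤ`. [folklore] -/
theorem fst_comp_boundaryHomeomorphAddCircle_eq :
    (⟨Prod.fst, continuous_fst⟩ : C(AddCircle (2 * Real.pi) × AddCircle (2 * Real.pi), AddCircle (2 * Real.pi))).comp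
        (boundaryHomeomorphAddCircle : C((𝓡∂ 3).boundary RoundSolidTorus, AddCircle (2 * Real.pi) × AddCircle (2 * Real.pi))) =
      longitudeMap.comp bdryIncl := by
  ext z
  exact (longitude_boundary z).symm

/-- `mapOfEq` along equal maps (the proof of the base-point equation is transported). [folklore] -/
theorem _root_.FundamentalGroup.mapOfEq_congr {X Y : Type*} [TopologicalSpace X] [TopologicalSpace Y]
    {f g : C(X, Y)} (e : f = g) {x : X} {y : Y} (h : f x = y) (γ : FundamentalGroup X x) :
    FundamentalGroup.mapOfEq f h γ = FundamentalGroup.mapOfEq g (e ▸ h) γ := by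
  subst e; rfl

/-- `pr₁_* (ω, 0) = [ω]`. [cite: HatcherAT2002, Prop. 1.12 (p. 34)] -/
theorem map_fst_torusLoop₁ (p : ℝ) :
    FundamentalGroup.map (⟨Prod.fst, continuous_fst⟩ : C(AddCircle p × AddCircle p, AddCircle p)) (0, 0)
        (torusLoop₁ p) =
      FundamentalGroup.fromPath (Path.Homotopic.Quotient.mk (addCircleLoop p 0)) := by
  rfl

/-- `pr₁_* (0, ω) = 1`. [cite: HatcherAT2002, Prop. 1.12 (p. 34)] -/
theorem map_fst_torusLoop₂ (p : ℝ) :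
    FundamentalGroup.map (⟨Prod.fst, continuous_fst⟩ : C(AddCircle p × AddCircle p, AddCircle p)) (0, 0)
        (torusLoop₂ p) = 1 := by
  rw [← fromPath_mk_refl]
  rfl

/-- **A class of `π₁(∂V, z₀)` dying in `V` has longitude exponent `0`**: the longitude angle
`V → ℝ/2πℤ` sends `g₁ ↦ [ω]` (a generator of `π₁(S¹) ≅ ℤ`, of infinite order, Hatcher Thm. 1.7)
and `g₂ ↦ 1`. [cite: HatcherAT2002, Thm. 1.7 (p. 29)] -/
theorem fst_eq_zero_of_map_incl_eq_one {γ : FundamentalGroup ((𝓡∂ 3).boundary RoundSolidTorus) basePt}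
    (hγ : FundamentalGroup.map bdryIncl basePt γ = 1) :
    ((fundamentalGroupTorusEquiv Real.two_pi_pos.ne' Real.two_pi_pos.ne' 0 0 (congrTorus γ)).toAdd).1 = 0 := by
  have hp : (2 * Real.pi : ℝ) ≠ 0 := Real.two_pi_pos.ne'
  set F := FundamentalGroup.map
    (⟨Prod.fst, continuous_fst⟩ : C(AddCircle (2 * Real.pi) × AddCircle (2 * Real.pi), AddCircle (2 * Real.pi))) (0, 0)
    with hF
  set m := ((fundamentalGroupTorusEquiv hp hp 0 0 (congrTorus γ)).toAdd).1
  set n := ((fundamentalGroupTorusEquiv hp hp 0 0 (congrTorus γ)).toAdd).2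
  -- `pr₁_* (congrTorus γ) = [ω]^m`
  have h1 : F (congrTorus γ) = FundamentalGroup.fromPath (Path.Homotopic.Quotient.mk (addCircleLoop (2 * Real.pi) 0)) ^ m := by
    conv_lhs => rw [eq_torusLoop₁_zpow_mul_torusLoop₂_zpow hp (congrTorus γ)]
    rw [map_mul, map_zpow, map_zpow, hF, map_fst_torusLoop₁, map_fst_torusLoop₂, one_zpow, mul_one]
  -- `pr₁_* (congrTorus γ) = longitude_* (incl_* γ) = 1`
  have h2 : F (congrTorus γ) = 1 := by
    have hb : (boundaryHomeomorphAddCircle :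
        C((𝓡∂ 3).boundary RoundSolidTorus, AddCircle (2 * Real.pi) × AddCircle (2 * Real.pi))) basePt = (0, 0) :=
      boundaryHomeomorphAddCircle_basePt
    have e1 : F (congrTorus γ) = FundamentalGroup.mapOfEq
        ((⟨Prod.fst, continuous_fst⟩ : C(AddCircle (2 * Real.pi) × AddCircle (2 * Real.pi), AddCircle (2 * Real.pi))).comp
          (boundaryHomeomorphAddCircle : C((𝓡∂ 3).boundary RoundSolidTorus, _)))
        (show _ = (0 : AddCircle (2 * Real.pi)) by rw [ContinuousMap.comp_apply, hb]; rfl) γ := by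
      rw [hF, ← mapOfEq_rfl_apply, Homeomorph.fundamentalGroupCongr_apply,
        ← mapOfEq_comp_apply _ _ hb rfl]
    have hg : longitudeMap (bdryIncl basePt) = 0 := by
      show (show AddCircle (2 * Real.pi) from longitude basePt.1) = 0
      have h0 := longitude_boundary basePt
      rw [boundaryHomeomorphAngle_basePt] at h0
      exact h0
    rw [e1, FundamentalGroup.mapOfEq_congr fst_comp_boundaryHomeomorphAddCircle_eq,
      mapOfEq_comp_apply bdryIncl longitudeMap rfl hg, mapOfEq_rfl_apply, hγ, map_one]
  rw [h2] at h1
  exact ((addCircleLoop_zpow_eq_one_iff hp 0 m).1 h1.symm)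

/-- **The kernel of `π₁(∂V, z₀) → π₁(V, z₀)` is the cyclic group generated by the meridian**
(for the boundary datum `BoundaryManifold.boundaryData 2 V`, inclusion `Subtype.val`): the
genus-`1` case of "`ker (π₁ ∂H → π₁ H)` is normally generated by the meridians of the handlebody"
(Hempel, *3-Manifolds* (1976), Ch. 14, p. 158). [cite: Hempel1976, Ch. 14 p. 158] -/
theorem ker_map_incl_eq_zpowers_meridianClass :
    (FundamentalGroup.map bdryIncl basePt).ker = Subgroup.zpowers meridianClass := by
  apply le_antisymm
  · intro γ hγ
    rw [MonoidHom.mem_ker] at hγ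
    have h0 := fst_eq_zero_of_map_incl_eq_one hγ
    rw [eq_longitudeClass_zpow_mul_meridianClass_zpow γ, h0, zpow_zero, one_mul]
    exact Subgroup.zpow_mem_zpowers _ _
  · rw [Subgroup.zpowers_le, MonoidHom.mem_ker]
    exact map_incl_meridianClass

/-- The meridian class lies in the kernel. [cite: Hempel1976, Ch. 14 p. 158] -/
theorem meridianClass_mem_ker : meridianClass ∈ (FundamentalGroup.map bdryIncl basePt).ker := by
  rw [ker_map_incl_eq_zpowers_meridianClass]; exact Subgroup.mem_zpowers _

/-- **The meridian has infinite order** in `π₁(∂V, z₀)`: `g₂ⁿ = 1 ↔ n = 0`. [cite: HatcherAT2002, Example 1.13 (p. 34)] -/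
theorem meridianClass_zpow_eq_one_iff (n : ℤ) : meridianClass ^ n = 1 ↔ n = 0 := by
  have hp : (2 * Real.pi : ℝ) ≠ 0 := Real.two_pi_pos.ne'
  constructor
  · intro h
    have h1 : torusLoop₂ (2 * Real.pi) ^ n = 1 := by
      have h' := congrArg congrTorus h
      rwa [map_zpow, congrTorus_meridianClass, map_one] at h'
    have h2 := fundamentalGroupTorusEquiv_zpow_mul_zpow hp 0 n
    rw [zpow_zero, one_mul, h1, map_one] at h2
    have h3 := congrArg (fun x : Multiplicative (ℤ × ℤ) => (Multiplicative.toAdd x).2) h2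
    simpa using h3.symm
  · rintro rfl
    exact zpow_zero _

end RoundSolidTorusModel

end Literature.Topology.FourManifolds

end
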